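/-
Copyright (c) 2026 the pub-hodgecm-mathlib formalisation cell (harness21).  Prover seat hodgecm-mathlib-K2Liu-p06 (g3): Track B «K2-LIT»,
hLiu418 = stmt-HodgeConjecture-24832, LEAD F0P6-plan (g12) deal of record (req649 (S1) Φ2 `K2LiuSiegelEisensteinCoeffCells` «for det β ≠ 0 only the
big cell»), word 06:51:40Z «then REST = ⊔ orbits of [w_g m] … exactly what files 3–6 consume»; 2026-09-04.
-/
import Summits.HodgeConjecture.HodgeConjecture.Theorems.K2LiuSiegelLeviConjUnipDeltaChar        -- ★ Φ2 files 1–6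
import Summits.HodgeConjecture.HodgeConjecture.Theorems.K2LiuSiegelBruhatMiddleCellExhaustion   -- ★ B2c face (X)
import HarnessLib

/-!
# Crux `HLiu418`, ROAD Φ, organ Φ2 file 7: THE MIDDLE ORBITS DIE — for `det S ≠ 0` the `N_Δ(L⁺)`-orbit of every middle-cell coset `[w_χ p']`
# contributes `0` to the `S`-th Fourier coefficient of the Siegel Eisenstein series

Cell `hodgecm-mathlib`, crux item hLiu418 = `stmt-HodgeConjecture-24832`, route `HCCMUnconditional`; squad K2 ∕ K2Liu, LEAD F0P6-plan (g12), dealer K2E5-plan (g5),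
prover K2Liu-p06 (g3).  THEOREMS ONLY (imports ★ Φ2 files 1–6 and ★ B2c); lane `--supports stmt-HodgeConjecture-24832 --as helper` (count-neutral).

WHAT.  The glue between the Bruhat exhaustion (★ `K2LiuSiegelBruhatMiddleCellExhaustion`: REST cosets are `[w_χ p']`, `χ` a `0∕1` pattern with a zero
entry, `p' ∈ P_Δ(L⁺)`) and the orbit-vanishing machine (★ Φ2 files 2–6):
* §1 **`exists_orbit_stabilizer_datum`** — for `γ₀ = w_χ p'` and a non-degenerate `T_L`-skew index `S` (`det S ≠ 0`) there is `s₀ ∈ N_Δ(𝔸)` with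
  `γ₀ s₀ γ₀⁻¹ ∈ P_Δ(𝔸)`, trivial inducing character there, and `ψ_S(s₀) ≠ 1`: take the corner test element `u` of ★ file 5
  (`exists_corner_unipDeltaChar_ne_one_of_det_ne_zero`) for the conjugated index `S^{p'} = D₀ S A₀⁻¹` (★ file 6: skew, non-degenerate) and
  `s₀ = p'⁻¹ u p'` (★ `unipDeltaChar_conj_eq`); `γ₀ s₀ γ₀⁻¹ = w_χ u w_χ⁻¹` is Siegel with trivial character by ★ file 4 (`reflection_stabilizer_data`,
  corner condition `(1 − G) X (1 − G) = 4·diag(χ) X diag(χ) = 0`).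
* §2 **`isCoveringWeight_unfoldWeight_orbit`**, **`tsum_orbit_eq_zero`** — for ANY `γ₀ ∈ H(L⁺)` admitting such an `s₀`, the sum of the coefficient
  integrals `J_S(q) = ∫ β·conj ψ_S·f(γ_q u h)` over the orbit `O(γ₀) = {[γ₀ ν] : ν ∈ N_Δ(L⁺)}` vanishes: the orbit indexes itself as a section of
  `Stab(γ₀)\N_Δ(L⁺)` (★ file 3 `exists_stabilizer_subgroup`, `mk_mul_eq_mk_mul_iff`), the `Stab`-weight is the unfolded weight `Σ_q β(ν_q⁻¹ ·)`
  (★ `Literature.MeasureTheory.Group.coveringSum_unfoldWeight`), and ★ file 3 `tsum_section_eq_zero` applies.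
* §3 **`tsum_middle_orbit_eq_zero`** — §1 + §2 for `γ₀ = w_χ p'`.
The sequel (`K2LiuSiegelEisensteinCoeffNondegenerate`) partitions REST into these orbits and concludes `E_S = (∫β)⁻¹ · W_S(f)` for `det S ≠ 0`.
[KudlaRallis1994, §2], [Tan1999, §3], [Shimura1997, §18.3], [MoeglinWaldspurger1995, II.1.7].

HONEST LABEL.  Count-neutral helper; `HC_CM` is proved only modulo the 7 printed citations (2 remaining named inputs: hLiu418 = `stmt-HodgeConjecture-24832`,
h413 = `stmt-HodgeConjecture-24833`) until rung 0 closes.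
-/

set_option autoImplicit false
set_option linter.dupNamespace false -- the mandated namespace repeats `HodgeConjecture.HodgeConjecture`

noncomputable section

open scoped Matrix ENNReal NNReal ComplexConjugate
open NumberField IsDedekindDomain MeasureTheory MeasureTheory.Measure Filter Set Function
open Literature.NumberTheory.Automorphic Literature.NumberTheory.Automorphic.UnitaryGroup Literature.NumberTheory.GaloisRepresentations
open Literature.NumberTheory.GelbartRogawski1991 Literature.NumberTheory.GelbartRogawski1991.GRConstruction
open Literature.NumberTheory.K2Lit.SiegelDoubled Literature.MeasureTheory.Group
open UnitaryDualPair

namespace Summit.HodgeConjecture.HodgeConjecture.Cruxes.HLiu418.K2LiuSiegelEisensteinCoeffMiddleOrbits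

open K2LiuUnipotentCoveringWeight K2LiuConstantTermBigCellUnfold K2LiuSiegelDoubledUnfold K2LiuSiegelUnipotentFourierDefs K2LiuSiegelUnipotentCharacters
  K2LiuSiegelEisensteinCoeffCells K2LiuSiegelEisensteinCoeffOrbitVanishing K2LiuSiegelEisensteinCoeffOrbitSum K2LiuSiegelBruhatMiddleCellDelta
  K2LiuSiegelMiddleStabilizerCharacter K2LiuSiegelMiddleStabilizerNontrivial K2LiuSiegelLeviConjUnipDeltaChar K2LiuSiegelBruhatMiddleCellExhaustion

variable {L : Type} [Field L] [NumberField L] [IsCMField L]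
variable {N M n : ℕ} {e : Fin N × Fin M ≃ Fin n}
  {dV : Fin N → L} {hdV : ∀ i, IsCMField.complexConj L (dV i) = dV i}
  {dW : Fin M → L} {hdW : ∀ i, IsCMField.complexConj L (dW i) = dW i}

/-! ## §1 The stabiliser datum of a middle orbit for a non-degenerate index -/

/-- **THE STABILISER DATUM OF A MIDDLE ORBIT**: let `w = ι(1, γ_χ ⊗ 1)` for a rational sign involution of a `0∕1` pattern `χ` with `χ k₀ = 0`, `p' ∈ P_Δ(L⁺)`,
and `S` a `T_L`-skew index with `det S ≠ 0`.  Then some `s₀ ∈ N_Δ(𝔸)` has `(w p') s₀ (w p')⁻¹ ∈ P_Δ(𝔸)` with trivial inducing character and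
`ψ_S(s₀) ≠ 1`: `s₀ = p'⁻¹ u p'` for the corner test element `u` of ★ file 5 applied to `S^{p'} = D₀ S A₀⁻¹` (★ file 6); `(w p') s₀ (w p')⁻¹ = w u w⁻¹`
(★ file 4). [cite: MoeglinWaldspurger1995, II.1.7] [cite: Shimura1997, §18.3] [cite: KudlaRallis1994, §2] -/
theorem exists_orbit_stabilizer_datum (hdV0 : ∀ i, dV i ≠ 0) (hdW0 : ∀ i, dW i ≠ 0) (χH : HeckeCharacter L) (s : ℂ)
    {g : UnitaryGroup.rationalPair (Fp L) L (IsCMField.complexConj L) N M (Matrix.diagonal dV) (Matrix.diagonal dW)} {χ : Fin n → L}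
    (hχ : ∀ k, χ k = 0 ∨ χ k = 1) (hg : ((g : GL (Fin N × Fin M) L) : Matrix (Fin N × Fin M) (Fin N × Fin M) L) = Matrix.diagonal (fun k => 1 - 2 * χ (e k)))
    (hgg : g * g = 1) {k₀ : Fin n} (hk₀ : χ k₀ = 0) {p' : HA L e dV hdV dW hdW} (hp'r : p' ∈ ratH L e dV hdV dW hdW) (hp'P : IsSiegelDelta L e dV hdV dW hdW p')
    {S : Matrix (Fin n) (Fin n) L}
    (hS : S ∈ skewMatrices ((IsCMField.complexConj L : L ≃ₐ[Fp L] L) : L →+* L) ((gramR L e dV hdV dW hdW).map (algebraMap (Fp L) L))) (hdet : S.det ≠ 0) :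
    ∃ s₀ : HA L e dV hdV dW hdW, s₀ ∈ unipDelta L e dV hdV dW hdW ∧
      IsSiegelDelta L e dV hdV dW hdW (iotaGG L e dV hdV dW hdW
          (1, UnitaryGroup.rationalPairToAdelic (Fp L) L (IsCMField.complexConj L) N M (Matrix.diagonal dV) (Matrix.diagonal dW) g) * p' * s₀ *
        (iotaGG L e dV hdV dW hdW (1, UnitaryGroup.rationalPairToAdelic (Fp L) L (IsCMField.complexConj L) N M (Matrix.diagonal dV) (Matrix.diagonal dW) g) * p')⁻¹) ∧
      siegelDeltaCharacter L e dV hdV dW hdW χH s (iotaGG L e dV hdV dW hdW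
          (1, UnitaryGroup.rationalPairToAdelic (Fp L) L (IsCMField.complexConj L) N M (Matrix.diagonal dV) (Matrix.diagonal dW) g) * p' * s₀ *
        (iotaGG L e dV hdV dW hdW (1, UnitaryGroup.rationalPairToAdelic (Fp L) L (IsCMField.complexConj L) N M (Matrix.diagonal dV) (Matrix.diagonal dW) g) * p')⁻¹) = 1 ∧
      unipDeltaChar L e dV hdV dW hdW S s₀ ≠ 1 := by
  obtain ⟨A₀, D₀, hA₀, ha, hd, hrel⟩ := exists_rat_levi_blocks L e dV hdV dW hdW hdV0 hdW0 hp'P hp'r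
  have hS' := conj_index_mem_skewMatrices L e dV hdV dW hdW hdV0 hdW0 hA₀ hrel hS
  have hdet' : (D₀ * S * A₀⁻¹).det ≠ 0 := (det_conj_index_ne_zero_iff L e dV hdV dW hdW hdV0 hdW0 hA₀ hrel S).2 hdet
  have hdpat := pattern_map L hχ
  have hk₀' : algebraMap L (AdeleRing (𝓞 L) L) (χ k₀) = 0 := by rw [hk₀, map_zero]
  obtain ⟨u, huN, hcorner, hne⟩ := exists_corner_unipDeltaChar_ne_one_of_det_ne_zero L e dV hdV dW hdW hdV0 hdW0 hdpat hk₀' hS' hdet'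
  refine ⟨p'⁻¹ * u * p', conj_mem_unipDelta L e dV hdV dW hdW hp'P huN, ?_⟩
  have hconj : iotaGG L e dV hdV dW hdW
          (1, UnitaryGroup.rationalPairToAdelic (Fp L) L (IsCMField.complexConj L) N M (Matrix.diagonal dV) (Matrix.diagonal dW) g) * p' * (p'⁻¹ * u * p') *
        (iotaGG L e dV hdV dW hdW (1, UnitaryGroup.rationalPairToAdelic (Fp L) L (IsCMField.complexConj L) N M (Matrix.diagonal dV) (Matrix.diagonal dW) g) * p')⁻¹ =
      iotaGG L e dV hdV dW hdW (1, UnitaryGroup.rationalPairToAdelic (Fp L) L (IsCMField.complexConj L) N M (Matrix.diagonal dV) (Matrix.diagonal dW) g) * u *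
        (iotaGG L e dV hdV dW hdW (1, UnitaryGroup.rationalPairToAdelic (Fp L) L (IsCMField.complexConj L) N M (Matrix.diagonal dV) (Matrix.diagonal dW) g))⁻¹ := by
    rw [mul_inv_rev]
    simp only [mul_assoc, mul_inv_cancel_left]
  have hgg' : UnitaryGroup.rationalPairToAdelic (Fp L) L (IsCMField.complexConj L) N M (Matrix.diagonal dV) (Matrix.diagonal dW) g *
      UnitaryGroup.rationalPairToAdelic (Fp L) L (IsCMField.complexConj L) N M (Matrix.diagonal dV) (Matrix.diagonal dW) g = 1 := by
    rw [← map_mul, hgg, map_one]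
  have hX : (1 - Matrix.reindex e e (((UnitaryGroup.rationalPairToAdelic (Fp L) L (IsCMField.complexConj L) N M (Matrix.diagonal dV) (Matrix.diagonal dW) g :
        UnitaryGroup.adelicPair (Fp L) L (IsCMField.complexConj L) N M (Matrix.diagonal dV) (Matrix.diagonal dW)) :
        GL (Fin N × Fin M) (AdeleRing (𝓞 L) L)) : Matrix (Fin N × Fin M) (Fin N × Fin M) (AdeleRing (𝓞 L) L))) * (blk L e dV hdV dW hdW u).toBlocks₁₂ *
      (1 - Matrix.reindex e e (((UnitaryGroup.rationalPairToAdelic (Fp L) L (IsCMField.complexConj L) N M (Matrix.diagonal dV) (Matrix.diagonal dW) g :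
        UnitaryGroup.adelicPair (Fp L) L (IsCMField.complexConj L) N M (Matrix.diagonal dV) (Matrix.diagonal dW)) :
        GL (Fin N × Fin M) (AdeleRing (𝓞 L) L)) : Matrix (Fin N × Fin M) (Fin N × Fin M) (AdeleRing (𝓞 L) L))) = 0 := by
    rw [one_sub_reindex_signInvolution L e dV dW hg]
    simp only [Matrix.smul_mul, Matrix.mul_smul, hcorner, smul_zero]
  obtain ⟨hP, hχ1⟩ := reflection_stabilizer_data L e dV hdV dW hdW χH s hgg' huN hX
  rw [hconj]
  exact ⟨hP, hχ1, by rwa [unipDeltaChar_conj_eq L e dV hdV dW hdW hp'P hA₀ ha hd S huN]⟩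

/-! ## §2 The sum over one `N_Δ(L⁺)`-orbit vanishes -/

section Orbit

variable [MeasurableSpace (unipDelta L e dV hdV dW hdW)] [BorelSpace (unipDelta L e dV hdV dW hdW)]

/-- **the unfolded weight of the orbit section is a `Stab(γ₀)`-covering weight**: for `Γ' ≤ N_Δ(L⁺)` and representatives `ν i ∈ N_Δ(L⁺)` of the right
cosets `Γ'\N_Δ(L⁺)` (`∀ γ, ∃! i, γ ν_i⁻¹ ∈ Γ'`), `β'(x) = Σ_i β(ν_i⁻¹ x)` is a `Γ'`-weight when `β` is an `N_Δ(L⁺)`-weight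
(★ `coveringSum_unfoldWeight`). [cite: MoeglinWaldspurger1995, II.1.6] -/
theorem isCoveringWeight_unfoldWeight_orbit {β : unipDelta L e dV hdV dW hdW → ℝ≥0∞} (hβ : IsCoveringWeight (unipDeltaRat L e dV hdV dW hdW) β)
    (Γ' : Subgroup (unipDelta L e dV hdV dW hdW)) (hΓ'le : Γ' ≤ unipDeltaRat L e dV hdV dW hdW) {ι : Type*} [Countable ι]
    (ν : ι → unipDeltaRat L e dV hdV dW hdW) (hν : ∀ γ ∈ unipDeltaRat L e dV hdV dW hdW, ∃! i, γ * ((ν i : unipDelta L e dV hdV dW hdW))⁻¹ ∈ Γ') :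
    IsCoveringWeight Γ' (unfoldWeight β (fun i => (ν i : unipDelta L e dV hdV dW hdW))) := by
  haveI : MeasurableConstSMul (unipDelta L e dV hdV dW hdW) (unipDelta L e dV hdV dW hdW) := ⟨fun g => measurable_const_mul g⟩
  refine ⟨measurable_unfoldWeight hβ.1 _, fun x => ?_⟩
  rw [coveringSum_unfoldWeight (unipDeltaRat L e dV hdV dW hdW) Γ' hΓ'le β (fun i => (ν i).2) hν x]
  exact hβ.2 x

/-- **THE SUM OVER ONE ORBIT VANISHES.**  `νN` left-invariant on `N_Δ(𝔸)`, `β` an `N_Δ(L⁺)`-covering weight, `f` a continuous Siegel section, `γ₀ ∈ H(L⁺)`,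
`h ∈ H(𝔸)`, `S` an index; `O(γ₀) = {[γ₀ ν] : ν ∈ N_Δ(L⁺)} ⊆ P_Δ(L⁺)\H(L⁺)` its orbit.  If some `s₀ ∈ N_Δ(𝔸)` has `γ₀ s₀ γ₀⁻¹ ∈ P_Δ(𝔸)` with trivial
inducing character and `ψ_S(s₀) ≠ 1`, and the orbit is absolutely integrable against `β`, then
`Σ_{q ∈ O(γ₀)} ∫ β(u)·conj ψ_S(u)·f(γ_q u h) dνN(u) = 0` — ★ file 3 `tsum_section_eq_zero` for the section `q ↦ ν_q` (`[γ₀ ν_q] = q`) of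
`Stab(γ₀)\N_Δ(L⁺)`, the unfolded weight of §2, and ★ `apply_out_orbit` (`f(γ_q x) = f(γ₀ ν_q x)`).
[cite: MoeglinWaldspurger1995, II.1.7] [cite: KudlaRallis1994, §2] [cite: Tan1999, §3] -/
theorem tsum_orbit_eq_zero (νN : Measure (unipDelta L e dV hdV dW hdW)) [νN.IsMulLeftInvariant]
    {β : unipDelta L e dV hdV dW hdW → ℝ≥0∞} (hβ : IsCoveringWeight (unipDeltaRat L e dV hdV dW hdW) β)
    {χ : HeckeCharacter L} {s : ℂ} {f : HA L e dV hdV dW hdW → ℂ} (hf : IsSiegelDeltaSection L e dV hdV dW hdW χ s f) (hfc : Continuous f)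
    (γ₀ : ratH L e dV hdV dW hdW) (h : HA L e dV hdV dW hdW) (S : Matrix (Fin n) (Fin n) L)
    (hO : ∫⁻ u, (∑' q : ↥(Set.range (fun ν : unipDeltaRat L e dV hdV dW hdW =>
        (Quotient.mk (MulAction.orbitRel (siegelDeltaRat L e dV hdV dW hdW) (ratH L e dV hdV dW hdW))
          (γ₀ * ⟨((ν : unipDelta L e dV hdV dW hdW) : HA L e dV hdV dW hdW), coe_mem_ratH ν⟩)))),
        ‖f (((Quotient.out q.1 : ratH L e dV hdV dW hdW) : HA L e dV hdV dW hdW) * ((u : HA L e dV hdV dW hdW) * h))‖ₑ) * β u ∂νN ≠ ∞)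
    {s₀ : unipDelta L e dV hdV dW hdW}
    (hs₀P : IsSiegelDelta L e dV hdV dW hdW ((γ₀ : HA L e dV hdV dW hdW) * (s₀ : HA L e dV hdV dW hdW) * ((γ₀ : HA L e dV hdV dW hdW))⁻¹))
    (hs₀χ : siegelDeltaCharacter L e dV hdV dW hdW χ s ((γ₀ : HA L e dV hdV dW hdW) * (s₀ : HA L e dV hdV dW hdW) * ((γ₀ : HA L e dV hdV dW hdW))⁻¹) = 1)
    (hs₀ : unipDeltaChar L e dV hdV dW hdW S (s₀ : HA L e dV hdV dW hdW) ≠ 1) :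
    ∑' q : ↥(Set.range (fun ν : unipDeltaRat L e dV hdV dW hdW =>
        (Quotient.mk (MulAction.orbitRel (siegelDeltaRat L e dV hdV dW hdW) (ratH L e dV hdV dW hdW))
          (γ₀ * ⟨((ν : unipDelta L e dV hdV dW hdW) : HA L e dV hdV dW hdW), coe_mem_ratH ν⟩)))),
      ∫ u, (β u).toReal • (conj (unipDeltaChar L e dV hdV dW hdW S (u : HA L e dV hdV dW hdW) : ℂ) *
        f (((Quotient.out q.1 : ratH L e dV hdV dW hdW) : HA L e dV hdV dW hdW) * ((u : HA L e dV hdV dW hdW) * h))) ∂νN = 0 := by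
  classical
  haveI : Countable (unipDeltaRat L e dV hdV dW hdW) := countable_unipDeltaRat L e dV hdV dW hdW
  haveI : Countable (ratH L e dV hdV dW hdW) := countable_ratH L e dV hdV dW hdW
  haveI : Countable (SiegelDeltaQuot L e dV hdV dW hdW) := by unfold SiegelDeltaQuot; exact inferInstance
  -- the stabiliser and the orbit as its own section
  obtain ⟨Γ', hΓ'⟩ := exists_stabilizer_subgroup γ₀
  have hΓ'le : Γ' ≤ unipDeltaRat L e dV hdV dW hdW := fun u hu => (mem_unipDeltaRat_iff L e dV hdV dW hdW u).2 ((hΓ' u).1 hu).1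
  have hΓ'P : ∀ γ ∈ Γ', IsSiegelDelta L e dV hdV dW hdW
      ((γ₀ : HA L e dV hdV dW hdW) * ((γ : unipDelta L e dV hdV dW hdW) : HA L e dV hdV dW hdW) * ((γ₀ : HA L e dV hdV dW hdW))⁻¹) :=
    fun γ hγ => ((hΓ' γ).1 hγ).2
  haveI : Countable Γ' := (Subgroup.inclusion_injective hΓ'le).countable
  set mk : ratH L e dV hdV dW hdW → SiegelDeltaQuot L e dV hdV dW hdW :=
    Quotient.mk (MulAction.orbitRel (siegelDeltaRat L e dV hdV dW hdW) (ratH L e dV hdV dW hdW)) with hmk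
  -- `ι ν := ν` seen in `H(L⁺)`; `ι (a b⁻¹) = ι a (ι b)⁻¹`
  have hιmul : ∀ a b : unipDeltaRat L e dV hdV dW hdW, (⟨(((a * b⁻¹) : unipDelta L e dV hdV dW hdW) : HA L e dV hdV dW hdW), coe_mem_ratH (a * b⁻¹)⟩ : ratH L e dV hdV dW hdW) = (⟨(((a) : unipDelta L e dV hdV dW hdW) : HA L e dV hdV dW hdW), coe_mem_ratH (a)⟩ : ratH L e dV hdV dW hdW) * ((⟨(((b) : unipDelta L e dV hdV dW hdW) : HA L e dV hdV dW hdW), coe_mem_ratH (b)⟩ : ratH L e dV hdV dW hdW))⁻¹ := fun a b => rfl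
  -- `[γ₀ a] = [γ₀ b] ⟺ a b⁻¹ ∈ Γ'`
  have hstab : ∀ a b : unipDeltaRat L e dV hdV dW hdW, mk (γ₀ * (⟨(((a) : unipDelta L e dV hdV dW hdW) : HA L e dV hdV dW hdW), coe_mem_ratH (a)⟩ : ratH L e dV hdV dW hdW)) = mk (γ₀ * (⟨(((b) : unipDelta L e dV hdV dW hdW) : HA L e dV hdV dW hdW), coe_mem_ratH (b)⟩ : ratH L e dV hdV dW hdW)) →
      (a : unipDelta L e dV hdV dW hdW) * (b : unipDelta L e dV hdV dW hdW)⁻¹ ∈ Γ' := by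
    intro a b hab
    have hab' : mk (γ₀ * (⟨(((a * b⁻¹) : unipDelta L e dV hdV dW hdW) : HA L e dV hdV dW hdW), coe_mem_ratH (a * b⁻¹)⟩ : ratH L e dV hdV dW hdW)) = mk γ₀ := by
      rw [hιmul]; exact (mk_mul_eq_mk_mul_iff γ₀ _ _).1 hab
    exact (hΓ' _).2 ⟨(mem_unipDeltaRat_iff L e dV hdV dW hdW _).1 (a * b⁻¹).2, (mk_mul_coe_eq_mk_iff γ₀ (a * b⁻¹)).1 hab'⟩
  have hstab' : ∀ a b : unipDeltaRat L e dV hdV dW hdW, (a : unipDelta L e dV hdV dW hdW) * (b : unipDelta L e dV hdV dW hdW)⁻¹ ∈ Γ' →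
      mk (γ₀ * (⟨(((a) : unipDelta L e dV hdV dW hdW) : HA L e dV hdV dW hdW), coe_mem_ratH (a)⟩ : ratH L e dV hdV dW hdW)) = mk (γ₀ * (⟨(((b) : unipDelta L e dV hdV dW hdW) : HA L e dV hdV dW hdW), coe_mem_ratH (b)⟩ : ratH L e dV hdV dW hdW)) := by
    intro a b hab
    have hab' : mk (γ₀ * (⟨(((a * b⁻¹) : unipDelta L e dV hdV dW hdW) : HA L e dV hdV dW hdW), coe_mem_ratH (a * b⁻¹)⟩ : ratH L e dV hdV dW hdW)) = mk γ₀ := (mk_mul_coe_eq_mk_iff γ₀ (a * b⁻¹)).2 ((hΓ' _).1 hab).2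
    rw [hιmul] at hab'
    exact (mk_mul_eq_mk_mul_iff γ₀ _ _).2 hab'
  -- the section `q ↦ ν q`, `[γ₀ ν_q] = q`
  have hsec : ∀ q : ↥(Set.range (fun ν : unipDeltaRat L e dV hdV dW hdW => mk (γ₀ * (⟨(((ν) : unipDelta L e dV hdV dW hdW) : HA L e dV hdV dW hdW), coe_mem_ratH (ν)⟩ : ratH L e dV hdV dW hdW)))),
      ∃ ν₁ : unipDeltaRat L e dV hdV dW hdW, mk (γ₀ * (⟨(((ν₁) : unipDelta L e dV hdV dW hdW) : HA L e dV hdV dW hdW), coe_mem_ratH (ν₁)⟩ : ratH L e dV hdV dW hdW)) = q.1 := fun q => q.2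
  choose ν hνq using hsec
  have hν : ∀ γ ∈ unipDeltaRat L e dV hdV dW hdW, ∃! i, γ * ((ν i : unipDelta L e dV hdV dW hdW))⁻¹ ∈ Γ' := by
    intro γ hγ
    refine ⟨⟨mk (γ₀ * (⟨((((⟨γ, hγ⟩ : unipDeltaRat L e dV hdV dW hdW)) : unipDelta L e dV hdV dW hdW) : HA L e dV hdV dW hdW), coe_mem_ratH ((⟨γ, hγ⟩ : unipDeltaRat L e dV hdV dW hdW))⟩ : ratH L e dV hdV dW hdW)), ⟨γ, hγ⟩, rfl⟩, hstab ⟨γ, hγ⟩ _ (by rw [hνq]), fun j hj => Subtype.ext ?_⟩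
    rw [← hνq j]
    exact (hstab' ⟨γ, hγ⟩ _ hj).symm
  -- integrand identification `f(γ_q x) = f(γ₀ ν_q x)`
  have hout : ∀ (q : ↥(Set.range (fun ν : unipDeltaRat L e dV hdV dW hdW => mk (γ₀ * (⟨(((ν) : unipDelta L e dV hdV dW hdW) : HA L e dV hdV dW hdW), coe_mem_ratH (ν)⟩ : ratH L e dV hdV dW hdW))))) (x : HA L e dV hdV dW hdW),
      f (((Quotient.out q.1 : ratH L e dV hdV dW hdW) : HA L e dV hdV dW hdW) * x) =
        f ((γ₀ : HA L e dV hdV dW hdW) * (((ν q : unipDelta L e dV hdV dW hdW)) : HA L e dV hdV dW hdW) * x) := by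
    intro q x
    rw [← apply_out_orbit hf γ₀ (ν q) x]
    congr 4
    exact (hνq q).symm
  have hβ' := isCoveringWeight_unfoldWeight_orbit hβ Γ' hΓ'le ν hν
  have hO' : ∫⁻ u, (∑' i, ‖f ((γ₀ : HA L e dV hdV dW hdW) * (((ν i : unipDelta L e dV hdV dW hdW)) : HA L e dV hdV dW hdW) *
      ((u : HA L e dV hdV dW hdW) * h))‖ₑ) * β u ∂νN ≠ ∞ := by
    simp only [hout] at hO
    exact hO
  have key := tsum_section_eq_zero νN hβ hf hfc γ₀ h S Γ' hΓ'le hΓ'P hβ' ν hν hO' hs₀P hs₀χ hs₀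
  simp only [hout]
  exact key

end Orbit

/-! ## §3 The middle orbits of a non-degenerate index die -/

section Middle

variable [MeasurableSpace (unipDelta L e dV hdV dW hdW)] [BorelSpace (unipDelta L e dV hdV dW hdW)]

/-- **THE MIDDLE ORBIT `O(w_χ p')` CONTRIBUTES ZERO FOR `det S ≠ 0`** (`S` `T_L`-skew; `χ` a `0∕1` pattern with `χ k₀ = 0`; `p' ∈ P_Δ(L⁺)`): §1 + §2.
[cite: KudlaRallis1994, §2] [cite: Tan1999, §3] [cite: Shimura1997, §18.3] [cite: MoeglinWaldspurger1995, II.1.7] -/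
theorem tsum_middle_orbit_eq_zero (hdV0 : ∀ i, dV i ≠ 0) (hdW0 : ∀ i, dW i ≠ 0) (νN : Measure (unipDelta L e dV hdV dW hdW)) [νN.IsMulLeftInvariant]
    {β : unipDelta L e dV hdV dW hdW → ℝ≥0∞} (hβ : IsCoveringWeight (unipDeltaRat L e dV hdV dW hdW) β)
    {χH : HeckeCharacter L} {s : ℂ} {f : HA L e dV hdV dW hdW → ℂ} (hf : IsSiegelDeltaSection L e dV hdV dW hdW χH s f) (hfc : Continuous f)
    {g : UnitaryGroup.rationalPair (Fp L) L (IsCMField.complexConj L) N M (Matrix.diagonal dV) (Matrix.diagonal dW)} {χ : Fin n → L}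
    (hχ : ∀ k, χ k = 0 ∨ χ k = 1) (hg : ((g : GL (Fin N × Fin M) L) : Matrix (Fin N × Fin M) (Fin N × Fin M) L) = Matrix.diagonal (fun k => 1 - 2 * χ (e k)))
    (hgg : g * g = 1) {k₀ : Fin n} (hk₀ : χ k₀ = 0) {p' : HA L e dV hdV dW hdW} (hp'r : p' ∈ ratH L e dV hdV dW hdW) (hp'P : IsSiegelDelta L e dV hdV dW hdW p')
    (hγ₀ : iotaGG L e dV hdV dW hdW (1, UnitaryGroup.rationalPairToAdelic (Fp L) L (IsCMField.complexConj L) N M (Matrix.diagonal dV) (Matrix.diagonal dW) g) * p' ∈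
      ratH L e dV hdV dW hdW)
    (h : HA L e dV hdV dW hdW) {S : Matrix (Fin n) (Fin n) L}
    (hS : S ∈ skewMatrices ((IsCMField.complexConj L : L ≃ₐ[Fp L] L) : L →+* L) ((gramR L e dV hdV dW hdW).map (algebraMap (Fp L) L))) (hdet : S.det ≠ 0)
    (hO : ∫⁻ u, (∑' q : ↥(Set.range (fun ν : unipDeltaRat L e dV hdV dW hdW =>
        (Quotient.mk (MulAction.orbitRel (siegelDeltaRat L e dV hdV dW hdW) (ratH L e dV hdV dW hdW))
          ((⟨_, hγ₀⟩ : ratH L e dV hdV dW hdW) * ⟨((ν : unipDelta L e dV hdV dW hdW) : HA L e dV hdV dW hdW), coe_mem_ratH ν⟩)))),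
        ‖f (((Quotient.out q.1 : ratH L e dV hdV dW hdW) : HA L e dV hdV dW hdW) * ((u : HA L e dV hdV dW hdW) * h))‖ₑ) * β u ∂νN ≠ ∞) :
    ∑' q : ↥(Set.range (fun ν : unipDeltaRat L e dV hdV dW hdW =>
        (Quotient.mk (MulAction.orbitRel (siegelDeltaRat L e dV hdV dW hdW) (ratH L e dV hdV dW hdW))
          ((⟨_, hγ₀⟩ : ratH L e dV hdV dW hdW) * ⟨((ν : unipDelta L e dV hdV dW hdW) : HA L e dV hdV dW hdW), coe_mem_ratH ν⟩)))),
      ∫ u, (β u).toReal • (conj (unipDeltaChar L e dV hdV dW hdW S (u : HA L e dV hdV dW hdW) : ℂ) *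
        f (((Quotient.out q.1 : ratH L e dV hdV dW hdW) : HA L e dV hdV dW hdW) * ((u : HA L e dV hdV dW hdW) * h))) ∂νN = 0 := by
  obtain ⟨s₀, hs₀N, hP, hχ1, hne⟩ := exists_orbit_stabilizer_datum hdV0 hdW0 χH s hχ hg hgg hk₀ hp'r hp'P hS hdet
  exact tsum_orbit_eq_zero νN hβ hf hfc ⟨_, hγ₀⟩ h S hO (s₀ := ⟨s₀, hs₀N⟩) hP hχ1 hne

end Middle

end Summit.HodgeConjecture.HodgeConjecture.Cruxes.HLiu418.K2LiuSiegelEisensteinCoeffMiddleOrbits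

end
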